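import Summits.BirchSwinnertonDyer.BirchSwinnertonDyer.Theorems.EquivariantChebotarevAtTwo.Negative.EquivariantChebotarevAtTwoFalseOfDiscFieldClassAtTwo

/-!
# Route `GenusKolyvaginAtTwo`, LINE 6, Q5 `EquivariantChebotarevAtTwo` (stmt-BirchSwinnertonDyer-24881):
# a GENERIC class at the discriminant field from TWO DISTINCT NON-ZERO `c`-INVARIANT classes
# (helper, PROVED; seat gk2-p2 g8)

The negative booking `GenusExact.equivariantChebotarevAtTwo_false_of_isSquare_discr_mul_of_generic`
(p609364) refutes Q5 as typed at every `(W, K)` of its range with `d_K · Δ_W ∈ ℚ^{×2}` (`K = ℚ(√Δ_W)`)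
modulo ONE class `x ∈ H¹(K, E[2])` that is *generic* with respect to its conjugate `x^c`
(`[x, ρ₁] ≠ 0 = [x^c, ρ₁]`, `[x, ρ₂] = 0 ≠ [x^c, ρ₂]` for some `ρ₁, ρ₂ ∈ Γ_{K(E[2])}`). This file
manufactures such a class from the cheapest possible input: TWO classes `u ≠ v`, both non-zero and
both fixed by `c_*` — in nature the Kummer classes over `K` of two points of `E(ℚ)` independent
modulo `2E(K)` (sequel file `…KummerInvariant`). The generic class is `x = u + ωv`, `ω = H¹(id, z)`
the `𝔽₄`-structure of the companion helper `…FourStructure` (p608069): `x^c = u + ω²v`, and on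
`Γ_{K(E[2])}` the pair `([u, ·], [v, ·])` is JOINTLY ONTO `E[2] × E[2]`, because its image is a
`z`-stable subgroup of the `4`-group squared which is not a graph `a = φ(b)`, `φ ∈ {0, 1, z, z²}`
(these four graphs are excluded, respectively, by `u ≠ 0`, `u ≠ v`, and — using `c ∘ ω = ω² ∘ c`
and the `c`-invariance — by `v ≠ 0` twice).

* §1 (pure algebra of the `4`-group `T`, `f` a fixed-point-free automorphism): a predicate `A` on
  `T × T` containing `(0,0)`, closed under `+` and under `f × f`, meeting the five non-degeneracy
  witnesses, holds everywhere (`forall_of_pairClosed`); the graph case (`eq_apply_of_graph`).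
* §2 `exists_generic_of_two_invariant` — the generic class; and the Q5-shaped consequence
  **`equivariantChebotarevAtTwo_false_of_two_invariant`**: Q5 as typed is false given a non-CM globally
  minimal `W/ℚ` with `Δ < 0` and `ρ_{W,2^n}` onto for all `n`, an imaginary quadratic `K` with
  `IsSquare (d_K · (−|Δ_W|))` (the NEGATION of the parent crux's binder), `c ≠ 1`, and two distinct
  non-zero `c_*`-invariant classes in `H¹(K, E[2])`.

HONEST FRAMING. Helper theorems (`--supports 24881`); no definition, no named fact, no `sorry`; the
repaired statement Q5′ (with the parent's binder) is PROVED (p606279). BSD is not proved by any of this.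

References: [GrossLMS1991] §9 (pairing `[s, ρ]`, Prop. 9.1, Prop. 9.3); [McCallumLMS1991] §3 (2)–(3),
Cor. 3.2; [LawsonWuthrich2016] Lemma 6; [SilvermanAEC2009] III.6.4, VIII.2.
-/

set_option autoImplicit false
set_option linter.dupNamespace false

noncomputable section

open scoped Classical

namespace Summit.BirchSwinnertonDyer.BirchSwinnertonDyer.Theorems.GenusExact

open WeierstrassCurve NumberField IsDedekindDomain Field Finset
open Literature.NumberTheory.GaloisRepresentations Literature.NumberTheory.EllipticCurves
open Literature.NumberTheory
open Summit.BirchSwinnertonDyer.BirchSwinnertonDyer.Theses.GenusKolyvaginAtTwo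

/-! ### §1 The `4`-group squared: `f`-stable additively closed predicates -/

section Four

variable {T : Type*} [AddCommGroup T]

/-- **The graph case.** `T` a `4`-group (`t + t = 0`, four elements), `f` a fixed-point-free
automorphism, `A ⊆ T × T` containing `(0, 0)`, closed under `+` and under `f × f`, and with NO
non-zero point on the axis `T × 0`. If `g` is an additive map commuting with `f` and `(g e, e) ∈ A`
for some `e ≠ 0`, then `A` lies on the graph `a = g b`. [folklore] -/
theorem eq_apply_of_graph (h2 : ∀ t : T, t + t = 0) (hcard : Nat.card T = 4)
    (f : T ≃+ T) (hf : ∀ t, f t = t → t = 0) {A : T → T → Prop}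
    (hadd : ∀ a b a' b', A a b → A a' b' → A (a + a') (b + b'))
    (hA : ∀ a b, A a b → A (f a) (f b)) (hU : ∀ d, A d 0 → d = 0)
    (g : T →+ T) (hg : ∀ t, g (f t) = f (g t)) {e : T} (he : e ≠ 0) (hge : A (g e) e) :
    ∀ a b, A a b → a = g b := by
  obtain ⟨hfe0, hfee, hffe⟩ :=
    KolyvaginImageTwo.apply_apply_eq_add_of_fixedPointFree h2 hcard f hf he
  -- `A` is functional in the second variable: two points over `b` differ by a point over `0`
  have hfun : ∀ a a' b, A a b → A a' b → a = a' := by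
    intro a a' b hab hab'
    have hs := hadd a b a' b hab hab'
    rw [h2 b] at hs
    have h0' : a + a' = 0 := hU _ hs
    -- `a = -a' = a'`
    have : a = -a' := eq_neg_of_add_eq_zero_left h0'
    rw [this, neg_eq_of_add_eq_zero_left (h2 a')]
  intro a b hab
  rcases KolyvaginImageTwo.mem_four h2 hcard he hfe0 hfee b with hb | hb | hb | hb <;>
    rw [hb] at hab ⊢
  · rw [map_zero]; exact hU a hab
  · exact hfun a _ e hab hge
  · have h1 : A (g (f e)) (f e) := by rw [hg]; exact hA _ _ hge
    exact hfun a _ _ hab h1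
  · have h1 : A (g (e + f e)) (e + f e) := by
      rw [map_add, hg]; exact hadd _ _ _ _ hge (hA _ _ hge)
    exact hfun a _ _ hab h1

/-- **`f`-stable additively closed predicates on the `4`-group squared.** With `T`, `f`, `A` as in
`eq_apply_of_graph` (no axis hypothesis), if `A` has a point with `a ≠ 0`, one with `b ≠ 0`, one
with `a ≠ b`, one with `a ≠ f b` and one with `a ≠ f (f b)`, then `A` is ALL of `T × T`. (Over
`𝔽₄ = 𝔽₂[f]`: an `𝔽₄`-subspace of `𝔽₄²` avoiding the axis `b = 0` and the four lines `a = φ b`,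
`φ ∈ 𝔽₄`, is everything.) [folklore] -/
theorem forall_of_pairClosed (h2 : ∀ t : T, t + t = 0) (hcard : Nat.card T = 4)
    (f : T ≃+ T) (hf : ∀ t, f t = t → t = 0) {A : T → T → Prop} (h0 : A 0 0)
    (hadd : ∀ a b a' b', A a b → A a' b' → A (a + a') (b + b'))
    (hA : ∀ a b, A a b → A (f a) (f b))
    (h₁ : ∃ a b, A a b ∧ a ≠ 0) (h₂ : ∃ a b, A a b ∧ b ≠ 0) (h₃ : ∃ a b, A a b ∧ a ≠ b)
    (h₄ : ∃ a b, A a b ∧ a ≠ f b) (h₅ : ∃ a b, A a b ∧ a ≠ f (f b)) :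
    ∀ a b, A a b := by
  obtain ⟨a₀, e, hmem, he⟩ := h₂
  obtain ⟨hfe0, hfee, hffe⟩ :=
    KolyvaginImageTwo.apply_apply_eq_add_of_fixedPointFree h2 hcard f hf he
  by_cases hU : ∀ d, A d 0 → d = 0
  · -- the graph case is excluded by the five witnesses
    exfalso
    rcases KolyvaginImageTwo.mem_four h2 hcard he hfe0 hfee a₀ with h | h | h | h
    · obtain ⟨a, b, hab, hne⟩ := h₁
      refine hne (eq_apply_of_graph h2 hcard f hf hadd hA hU 0 (fun t ↦ by simp) he ?_ a b hab)
      simpa [h] using hmem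
    · obtain ⟨a, b, hab, hne⟩ := h₃
      refine hne (eq_apply_of_graph h2 hcard f hf hadd hA hU (AddMonoidHom.id T)
        (fun t ↦ rfl) he ?_ a b hab)
      simpa [h] using hmem
    · obtain ⟨a, b, hab, hne⟩ := h₄
      refine hne (eq_apply_of_graph h2 hcard f hf hadd hA hU f.toAddMonoidHom
        (fun t ↦ rfl) he ?_ a b hab)
      simpa [h] using hmem
    · obtain ⟨a, b, hab, hne⟩ := h₅
      refine hne (eq_apply_of_graph h2 hcard f hf hadd hA hU
        (f.toAddMonoidHom.comp f.toAddMonoidHom) (fun t ↦ rfl) he ?_ a b hab)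
      have : f (f e) = a₀ := by rw [hffe, h]
      simpa [this] using hmem
  · -- a non-zero point on the axis: the axis is in `A`, and so is everything
    push Not at hU
    obtain ⟨d, hd, hd0⟩ := hU
    obtain ⟨hfd0, hfdd, hffd⟩ :=
      KolyvaginImageTwo.apply_apply_eq_add_of_fixedPointFree h2 hcard f hf hd0
    have hfd : A (f d) 0 := by simpa using hA _ _ hd
    have haxis : ∀ t, A t 0 := by
      intro t
      rcases KolyvaginImageTwo.mem_four h2 hcard hd0 hfd0 hfdd t with ht | ht | ht | ht <;> rw [ht]
      · exact h0
      · exact hd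
      · exact hfd
      · simpa using hadd _ _ _ _ hd hfd
    have hsec : ∀ s, ∃ a, A a s := by
      intro s
      rcases KolyvaginImageTwo.mem_four h2 hcard he hfe0 hfee s with hs | hs | hs | hs <;> rw [hs]
      · exact ⟨0, h0⟩
      · exact ⟨a₀, hmem⟩
      · exact ⟨f a₀, hA _ _ hmem⟩
      · exact ⟨a₀ + f a₀, hadd _ _ _ _ hmem (hA _ _ hmem)⟩
    intro a b
    obtain ⟨a', ha'⟩ := hsec b
    have := hadd _ _ _ _ ha' (haxis (a' + a))
    -- `(a' + (a' + a), b + 0) = (a, b)`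
    rwa [← add_assoc, h2 a', zero_add, add_zero] at this

end Four

/-! ### §2 The generic class `x = u + ωv` -/

section Main

set_option maxHeartbeats 1600000 in
/-- **A generic class from two distinct non-zero `c`-invariant classes.** For `W/ℚ` with `Δ < 0` and
`ρ_{W,2^n}` onto for all `n`, `K` imaginary quadratic with `c ≠ 1` and NO transposition in
`ρ̄_{W,2}(Γ_K)` (in nature `K = ℚ(√Δ_W)`), and classes `u ≠ v` in `H¹(K, E[2])`, both non-zero and both
fixed by `c_*`: the class `x = u + ωv` (`ω = H¹(id, z)`, `z ∈ Γ_K` of order-`3` type) is generic with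
respect to `x^c = u + ω²v` on `Γ_{K(E[2])}`. Proof: the joint evaluation `ρ ↦ ([u, ρ], [v, ρ])` is onto
`E[2] × E[2]` (`forall_of_pairClosed`; the four graphs are excluded by `u ≠ 0`, `u ≠ v` and — via
`c_* ∘ ω = ω² ∘ c_*` — by `v ≠ 0`), so some `ρ₁` has `([u, ρ₁], [v, ρ₁]) = (z²e, e)` and some `ρ₂`
has `(ze, e)`, `e ≠ 0`; then `[x, ρ₁] = e`, `[x^c, ρ₁] = 0`, `[x, ρ₂] = 0`, `[x^c, ρ₂] = e`.
[cite: GrossLMS1991, §9 (pairing [s, ρ], Prop. 9.1, Prop. 9.3)] [cite: LawsonWuthrich2016, Lemma 6] -/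
theorem exists_generic_of_two_invariant {K : Type} [Field K] [NumberField K]
    (W : WeierstrassCurve ℚ) [W.IsElliptic] (hΔ : W.Δ < 0) (hK : IsImaginaryQuadratic K)
    (hρ : ∀ n : ℕ, W.HasSurjectiveModNGaloisRep (2 ^ n : ℕ)) {c : K ≃ₐ[ℚ] K} (hc : c ≠ 1)
    (hA3 : ∀ (g : absoluteGaloisGroup K) (u : geomTorsion (W.baseChange K) ((2 ^ 1 : ℕ) : ℤ)),
      u ≠ 0 → g • u = u → ∀ w : geomTorsion (W.baseChange K) ((2 ^ 1 : ℕ) : ℤ), g • w = w)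
    {u v : galH1Torsion (W.baseChange K) ((2 ^ 1 : ℕ) : ℤ)}
    (hcu : conjAct W c ((2 ^ 1 : ℕ) : ℤ) u = u) (hcv : conjAct W c ((2 ^ 1 : ℕ) : ℤ) v = v)
    (hu0 : u ≠ 0) (hv0 : v ≠ 0) (huv : u ≠ v) :
    ∃ x : galH1Torsion (W.baseChange K) ((2 ^ 1 : ℕ) : ℤ),
      ∃ ρ₁ ∈ torsionFixing (W.baseChange K) ((2 ^ 1 : ℕ) : ℤ),
      ∃ ρ₂ ∈ torsionFixing (W.baseChange K) ((2 ^ 1 : ℕ) : ℤ),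
        h1Eval (W.baseChange K) ((2 ^ 1 : ℕ) : ℤ) x ρ₁ ≠ 0 ∧
        h1Eval (W.baseChange K) ((2 ^ 1 : ℕ) : ℤ) (conjAct W c ((2 ^ 1 : ℕ) : ℤ) x) ρ₁ = 0 ∧
        h1Eval (W.baseChange K) ((2 ^ 1 : ℕ) : ℤ) x ρ₂ = 0 ∧
        h1Eval (W.baseChange K) ((2 ^ 1 : ℕ) : ℤ) (conjAct W c ((2 ^ 1 : ℕ) : ℤ) x) ρ₂ ≠ 0 := by
  -- adapted from `exists_fourStructure_of_noTransposition` (p608069): the `𝔽₄`-structure `ω`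
  haveI : (W.baseChange K).IsElliptic := by rw [baseChange]; infer_instance
  have hsurj : W.HasSurjectiveModNGaloisRep 2 := by simpa using hρ 1
  have h2 := add_self_geomTorsion_twoPowOne (K := K) W
  have hcard := natCard_geomTorsion_twoPowOne (K := K) W
  have hneg : ∀ e : geomTorsion (W.baseChange K) ((2 ^ 1 : ℕ) : ℤ), -e = e :=
    fun e ↦ neg_eq_of_add_eq_zero_left (h2 e)
  -- ### the order-`3` element `z` and the coefficient endomorphism `ω = H¹(id, z)`
  obtain ⟨z, -, hzfix⟩ :=
    KolyvaginImageTwo.exists_smul_three_of_hasSurjectiveModNGaloisRep W K hK.1 hsurj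
  have hzfix' : ∀ P : geomTorsion (W.baseChange K) ((2 ^ 1 : ℕ) : ℤ), z • P = P → P = 0 :=
    fun P hP ↦ hzfix P hP
  let zA : geomTorsion (W.baseChange K) ((2 ^ 1 : ℕ) : ℤ) ≃+
      geomTorsion (W.baseChange K) ((2 ^ 1 : ℕ) : ℤ) := DistribMulAction.toAddEquiv _ z
  have hzA : ∀ t, zA t = z • t := fun _ ↦ rfl
  have hzz : ∀ e : geomTorsion (W.baseChange K) ((2 ^ 1 : ℕ) : ℤ),
      z • z • e + z • e + e = 0 := by
    intro e
    by_cases he : e = 0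
    · rw [he, smul_zero, smul_zero, add_zero, add_zero]
    · obtain ⟨-, -, hze⟩ :=
        KolyvaginImageTwo.apply_apply_eq_add_of_fixedPointFree h2 hcard zA hzfix' he
      rw [hzA, hzA] at hze
      have h3 : e + z • e + z • e + e = (z • e + z • e) + (e + e) := by abel
      rw [hze, h3, h2, h2, add_zero]
  -- `z² e + z e = e` and `z e + z² e = e`
  have hzz' : ∀ e : geomTorsion (W.baseChange K) ((2 ^ 1 : ℕ) : ℤ), z • z • e + z • e = e :=
    fun e ↦ (eq_neg_of_add_eq_zero_left (hzz e)).trans (hneg e)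
  let ψ : geomTorsion (W.baseChange K) ((2 ^ 1 : ℕ) : ℤ) →+
      geomTorsion (W.baseChange K) ((2 ^ 1 : ℕ) : ℤ) := DistribSMul.toAddMonoidHom _ z
  have hψapp : ∀ t, ψ t = z • t := fun _ ↦ rfl
  have hψ : ∀ (g : absoluteGaloisGroup K) (t : geomTorsion (W.baseChange K) ((2 ^ 1 : ℕ) : ℤ)),
      ψ (g • t) = g • ψ t := fun g t ↦ by
    rw [hψapp, hψapp, smul_comm_of_noTransposition W hA3 hzfix' g t]
  let ω := coeffH1Map (W.baseChange K) ((2 ^ 1 : ℕ) : ℤ) ψ hψ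
  have hωeval : ∀ (y : galH1Torsion (W.baseChange K) ((2 ^ 1 : ℕ) : ℤ)) {ρ : absoluteGaloisGroup K},
      ρ ∈ torsionFixing (W.baseChange K) ((2 ^ 1 : ℕ) : ℤ) →
        h1Eval (W.baseChange K) ((2 ^ 1 : ℕ) : ℤ) (ω y) ρ =
          z • h1Eval (W.baseChange K) ((2 ^ 1 : ℕ) : ℤ) y ρ :=
    fun y ρ hρ ↦ h1Eval_coeffH1Map ψ hψ y hρ
  -- restriction to `Γ_{K(E[2])}` is injective
  have hinj : ∀ y : galH1Torsion (W.baseChange K) ((2 ^ 1 : ℕ) : ℤ),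
      (∀ ρ ∈ torsionFixing (W.baseChange K) ((2 ^ 1 : ℕ) : ℤ),
        h1Eval (W.baseChange K) ((2 ^ 1 : ℕ) : ℤ) y ρ = 0) → y = 0 :=
    fun y hy ↦ KolyvaginImageTwo.h1_restriction_injective_two W K hK.1 hsurj hy
  -- ### `ω² + ω + 1 = 0`
  have hω1 : ∀ y, ω (ω y) + ω y + y = 0 := fun y ↦ by
    apply hinj
    intro ρ hρ
    rw [h1Eval_add _ _ _ _ hρ, h1Eval_add _ _ _ _ hρ, hωeval (ω y) hρ, hωeval y hρ]
    exact hzz _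
  -- ### the involutive lift of `c` acts on `E[2]` as a transposition; `c_* ∘ ω = ω² ∘ c_*`
  obtain ⟨c₀, hc₀⟩ := exists_isComplexConjugation (Rat.castHom ℝ)
  have ht : IsLiftOfAut c (absGaloisTransport (K := ℚ) (L := K) c₀).toRingEquiv :=
    RatClosure.isLiftOfAut_absGaloisTransport_of_isImaginaryQuadratic hK hc hc₀
  have hinv : ∀ y, (absGaloisTransport (K := ℚ) (L := K) c₀).toRingEquiv
      ((absGaloisTransport (K := ℚ) (L := K) c₀).toRingEquiv y) = y := fun y ↦
    RatClosure.absGaloisTransport_absGaloisTransport_of_sq_eq_one hc₀.sq_eq_one y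
  have hTT : ∀ e, ht.torsionMap W ((2 ^ 1 : ℕ) : ℤ) (ht.torsionMap W ((2 ^ 1 : ℕ) : ℤ) e) = e :=
    ht.torsionMap_torsionMap W hinv _
  obtain ⟨v₀, hv₀⟩ := KolyvaginEigenTwo.exists_twoTorsion_smul_ne_of_Δ_neg W hΔ hc₀
  let θ := RatClosure.torsionEquiv (K := K) W ((2 ^ 1 : ℕ) : ℤ)
  have hθ : ∀ P, ht.torsionMap W ((2 ^ 1 : ℕ) : ℤ) (θ P) = θ (c₀ • P) := fun P ↦
    (RatClosure.torsionEquiv_smul_of_lift W ht c₀ (fun _ ↦ rfl) _ P).symm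
  have hw : ht.torsionMap W ((2 ^ 1 : ℕ) : ℤ) (θ v₀) ≠ θ v₀ := by
    rw [hθ]
    exact fun h ↦ hv₀ (θ.injective h)
  have hfixsum : ht.torsionMap W ((2 ^ 1 : ℕ) : ℤ)
      (θ v₀ + ht.torsionMap W ((2 ^ 1 : ℕ) : ℤ) (θ v₀)) =
      θ v₀ + ht.torsionMap W ((2 ^ 1 : ℕ) : ℤ) (θ v₀) := by
    rw [map_add, hTT, add_comm]
  have hsum0 : θ v₀ + ht.torsionMap W ((2 ^ 1 : ℕ) : ℤ) (θ v₀) ≠ 0 := by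
    intro h0
    apply hw
    have h1 : ht.torsionMap W ((2 ^ 1 : ℕ) : ℤ) (θ v₀) = -θ v₀ := eq_neg_of_add_eq_zero_right h0
    rw [h1, neg_eq_iff_add_eq_zero, h2]
  have hkey : ∀ e, ht.torsionMap W ((2 ^ 1 : ℕ) : ℤ) (z • e) =
      z • z • ht.torsionMap W ((2 ^ 1 : ℕ) : ℤ) e :=
    transposition_conj_three W hTT hsum0 hfixsum hw hzfix'
  have hω2 : ∀ y, conjAct W c ((2 ^ 1 : ℕ) : ℤ) (ω y) =
      ω (ω (conjAct W c ((2 ^ 1 : ℕ) : ℤ) y)) := fun y ↦ by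
    rw [← sub_eq_zero]
    apply hinj
    intro ρ hρ
    have hρ'' := ht.conjGalCMH_mem_torsionFixing W hinv ((2 ^ 1 : ℕ) : ℤ) hρ
    rw [sub_eq_add_neg, h1Eval_add _ _ _ _ hρ, h1Eval_neg _ _ _ hρ,
      ht.h1Eval_conjAct W _ (ω y) hρ, hωeval y hρ'',
      hωeval (ω (conjAct W c ((2 ^ 1 : ℕ) : ℤ) y)) hρ, hωeval (conjAct W c ((2 ^ 1 : ℕ) : ℤ) y) hρ,
      ht.h1Eval_conjAct W _ y hρ, hkey, add_neg_cancel]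
  -- ### the conjugate of `x = u + ω v` is `u + ω (ω v)`
  set x := u + ω v with hx
  have hxc : conjAct W c ((2 ^ 1 : ℕ) : ℤ) x = u + ω (ω v) := by
    rw [hx, map_add, hcu, hω2, hcv]
  -- ### the joint evaluation `ρ ↦ ([u, ρ], [v, ρ])` is onto `E[2] × E[2]`
  let A : geomTorsion (W.baseChange K) ((2 ^ 1 : ℕ) : ℤ) →
      geomTorsion (W.baseChange K) ((2 ^ 1 : ℕ) : ℤ) → Prop := fun a b ↦
    ∃ ρ ∈ torsionFixing (W.baseChange K) ((2 ^ 1 : ℕ) : ℤ),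
      h1Eval (W.baseChange K) ((2 ^ 1 : ℕ) : ℤ) u ρ = a ∧
        h1Eval (W.baseChange K) ((2 ^ 1 : ℕ) : ℤ) v ρ = b
  have hA0 : A 0 0 := ⟨1, one_mem _, h1Eval_one _ _ u, h1Eval_one _ _ v⟩
  have hAadd : ∀ a b a' b', A a b → A a' b' → A (a + a') (b + b') := by
    rintro a b a' b' ⟨ρ, hρ, h1, h1'⟩ ⟨ρ', hρ', h3, h3'⟩
    exact ⟨ρ * ρ', mul_mem hρ hρ', by rw [h1Eval_mul _ _ u hρ, h1, h3],
      by rw [h1Eval_mul _ _ v hρ, h1', h3']⟩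
  have hAz : ∀ a b, A a b → A (zA a) (zA b) := by
    rintro a b ⟨ρ, hρ, h1, h1'⟩
    refine ⟨z * ρ * z⁻¹, (torsionFixing_normal _ _).conj_mem ρ hρ z, ?_, ?_⟩
    · rw [h1Eval_conj _ _ u z hρ, h1, hzA]
    · rw [h1Eval_conj _ _ v z hρ, h1', hzA]
  -- the five witnesses
  have hW₁ : ∃ a b, A a b ∧ a ≠ 0 := by
    by_contra h
    push Not at h
    exact hu0 (hinj u fun ρ hρ ↦ h _ _ ⟨ρ, hρ, rfl, rfl⟩)
  have hW₂ : ∃ a b, A a b ∧ b ≠ 0 := by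
    by_contra h
    push Not at h
    exact hv0 (hinj v fun ρ hρ ↦ h _ _ ⟨ρ, hρ, rfl, rfl⟩)
  have hW₃ : ∃ a b, A a b ∧ a ≠ b := by
    by_contra h
    push Not at h
    apply huv
    rw [← sub_eq_zero]
    refine hinj _ fun ρ hρ ↦ ?_
    rw [sub_eq_add_neg, h1Eval_add _ _ _ _ hρ, h1Eval_neg _ _ _ hρ, h _ _ ⟨ρ, hρ, rfl, rfl⟩,
      add_neg_cancel]
  -- `[u, ·] = z^k [v, ·]` forces `u = ω^k v`, then `c`-invariance forces `v = 0`
  have hvzero_of : ω v = ω (ω v) → False := by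
    intro hωω
    apply hv0
    refine hinj v fun ρ hρ ↦ hzfix' _ ?_
    have h := congrArg (fun s ↦ h1Eval (W.baseChange K) ((2 ^ 1 : ℕ) : ℤ) s ρ) hωω
    simp only [hωeval _ hρ] at h
    -- `h : z • [v, ρ] = z • z • [v, ρ]`
    exact (MulAction.injective z h).symm
  have hW₄ : ∃ a b, A a b ∧ a ≠ zA b := by
    by_contra h
    push Not at h
    -- `u = ω v`
    have huω : u = ω v := by
      rw [← sub_eq_zero]
      refine hinj _ fun ρ hρ ↦ ?_
      rw [sub_eq_add_neg, h1Eval_add _ _ _ _ hρ, h1Eval_neg _ _ _ hρ, hωeval v hρ,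
        h _ _ ⟨ρ, hρ, rfl, rfl⟩, hzA, add_neg_cancel]
    -- apply `c_*`: `u = c u = ω (ω (c v)) = ω (ω v)`
    have h' : ω v = ω (ω v) := by
      have := hcu
      rw [huω, hω2, hcv] at this
      exact this.symm
    exact hvzero_of h'
  have hW₅ : ∃ a b, A a b ∧ a ≠ zA (zA b) := by
    by_contra h
    push Not at h
    -- `u = ω (ω v)`
    have huω : u = ω (ω v) := by
      rw [← sub_eq_zero]
      refine hinj _ fun ρ hρ ↦ ?_
      rw [sub_eq_add_neg, h1Eval_add _ _ _ _ hρ, h1Eval_neg _ _ _ hρ, hωeval (ω v) hρ, hωeval v hρ,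
        h _ _ ⟨ρ, hρ, rfl, rfl⟩, hzA, hzA, add_neg_cancel]
    -- `ω³ = 1`
    have hω3 : ∀ y, ω (ω (ω y)) = y := fun y ↦ by
      have h1 := hω1 (ω y)
      have h0 := hω1 y
      -- `ω(ω(ωy)) = -ω(ωy) - ωy = y`
      have e1 : ω (ω (ω y)) = -(ω (ω y)) - ω y := by
        rw [eq_sub_iff_add_eq, eq_neg_iff_add_eq_zero, ← h1]; abel
      have e0 : y = -(ω (ω y)) - ω y := by
        rw [eq_sub_iff_add_eq, eq_neg_iff_add_eq_zero, ← h0]; abel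
      rw [e1, ← e0]
    -- apply `c_*`: `u = c u = c (ω (ω v)) = ω⁴ v = ω v`
    have h' : ω v = ω (ω v) := by
      have := hcu
      rw [huω, hω2, hω2, hcv, hω3] at this
      -- `this : ω v = ω (ω v)`… up to rewriting
      exact this
    exact hvzero_of h'
  have hall := forall_of_pairClosed h2 hcard zA hzfix' hA0 hAadd hAz hW₁ hW₂ hW₃ hW₄ hW₅
  -- ### the two Galois elements
  obtain ⟨-, e, ⟨-, -, -, -⟩, he⟩ := hW₂
  obtain ⟨ρ₁, hρ₁, hu₁, hv₁⟩ := hall (z • z • e) e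
  obtain ⟨ρ₂, hρ₂, hu₂, hv₂⟩ := hall (z • e) e
  refine ⟨x, ρ₁, hρ₁, ρ₂, hρ₂, ?_, ?_, ?_, ?_⟩
  · rw [hx, h1Eval_add _ _ _ _ hρ₁, hωeval v hρ₁, hu₁, hv₁, hzz']
    exact he
  · rw [hxc, h1Eval_add _ _ _ _ hρ₁, hωeval (ω v) hρ₁, hωeval v hρ₁, hu₁, hv₁, h2]
  · rw [hx, h1Eval_add _ _ _ _ hρ₂, hωeval v hρ₂, hu₂, hv₂, h2]
  · rw [hxc, h1Eval_add _ _ _ _ hρ₂, hωeval (ω v) hρ₂, hωeval v hρ₂, hu₂, hv₂, add_comm, hzz']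
    exact he

/-- **Q5 `EquivariantChebotarevAtTwo` as typed is false, given two distinct non-zero `c`-invariant
classes at the discriminant field.** Binders: `W/ℚ` globally minimal, non-CM, `Δ < 0`, `ρ_{W,2^n}` onto
for all `n`; `K` imaginary quadratic with `IsSquare ((d_K : ℚ) · (−|Δ_W|))` — the NEGATION of the
binder `¬ IsSquare ((NumberField.discr K : ℚ) * -|W.Δ|)` of the parent crux `KolyvaginExactAtTwo`
(22137), i.e. `K = ℚ(√Δ_W)` —, `c ≠ 1` in `Aut(K/ℚ)`, and classes `u ≠ v` of `H¹(K, E[2])`, non-zero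
and fixed by `c_*`. Proof: `exists_generic_of_two_invariant` (the Galois hypothesis from
`noTransposition_of_isSquare_discr_mul`, p608776) feeds the negative lemma
`equivariantChebotarevAtTwo_false_of_isSquare_discr_mul_of_generic` (p609364).
[cite: McCallumLMS1991, §3 Cor. 3.2 (hypothesis K ⊄ ℚ(E_p) of §3)] [cite: GrossLMS1991, §9 Prop. 9.1] -/
theorem equivariantChebotarevAtTwo_false_of_two_invariant
    (W : WeierstrassCurve ℚ) [W.IsElliptic] [W.IsGloballyMinimal] (hcm : ¬ W.HasCM) (hΔ : W.Δ < 0)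
    (K : Type) [Field K] [NumberField K] (hK : IsImaginaryQuadratic K)
    (hsq : IsSquare ((NumberField.discr K : ℚ) * -|W.Δ|))
    (hρ : ∀ n : ℕ, W.HasSurjectiveModNGaloisRep (2 ^ n : ℕ)) (c : K ≃ₐ[ℚ] K) (hc : c ≠ 1)
    (u v : galH1Torsion (W.baseChange K) ((2 ^ 1 : ℕ) : ℤ))
    (hcu : conjAct W c ((2 ^ 1 : ℕ) : ℤ) u = u) (hcv : conjAct W c ((2 ^ 1 : ℕ) : ℤ) v = v)
    (hu0 : u ≠ 0) (hv0 : v ≠ 0) (huv : u ≠ v) :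
    ¬ EquivariantChebotarevAtTwo := by
  have hsq' := (isSquare_discr_mul_iff_of_Δ_neg W hΔ K).mp hsq
  have hA3 := noTransposition_of_isSquare_discr_mul W K hK.1 hsq'
  obtain ⟨x, hgen⟩ := exists_generic_of_two_invariant W hΔ hK hρ hc hA3 hcu hcv hu0 hv0 huv
  exact equivariantChebotarevAtTwo_false_of_isSquare_discr_mul_of_generic W hcm hΔ K hK hsq hρ c hc
    x hgen

end Main

end Summit.BirchSwinnertonDyer.BirchSwinnertonDyer.Theorems.GenusExact

end
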